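import Mathlib.LinearAlgebra.FreeModule.PID
import Mathlib.LinearAlgebra.FreeModule.Finite.Basic
import Mathlib.RingTheory.Localization.Module
import Mathlib.FieldTheory.AlgebraicClosure
import Mathlib.Analysis.SpecialFunctions.Complex.Log
import Literature.NumberTheory.Transcendental.BakerLogarithmsConclusion

/-!
# `NormalFormPrinciple` (stmt-KontsevichZagierPeriods-3869), line `SketchIdeator1` — the leaf
# `stub_boxRigidity` in dimension one, VIII: the arithmetic of the algebraic-pole layer (Baker)

Pure proof file (lead seat c3; `--supports` the crux), independent of the move files. The next
layer of the leaf after the `ℚ`-split denominators (`…SplitVanishing.lean`) has real ALGEBRAIC poles;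
its values are `r + Σⱼ cⱼ log aⱼ` with real algebraic `r, cⱼ, aⱼ` (`aⱼ > 0`). The arithmetic input
replacing "`1, log 2, log 3, …` are `ℚ`-linearly independent" is BAKER'S THEOREM (tree, proved:
`Literature.NumberTheory.Transcendental.baker_holds`), used TORSION-FREE as in
`Cruxes/NormalFormPrinciple/Lines/SketchIdeator1-leaf-dim1.md`:

* `exists_mulBasis`: finitely many positive real algebraic numbers `aⱼ` are EXACT monomials
  `aⱼ = ∏ᵢ εᵢ^{nⱼᵢ}` (`nⱼᵢ ∈ ℤ`) in real algebraic numbers `εᵢ > 1` whose logarithms are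
  `ℚ`-linearly independent (a `ℤ`-basis of the lattice `ℤ log a₁ + ⋯ + ℤ log a_k ⊂ ℝ`, which is
  free because torsion-free);
* `eq_zero_of_alg_add_sum_mul_log_eq_zero` (registered sub-goal): if `log ε₁, …, log ε_s` are
  `ℚ`-linearly independent logarithms of real algebraic numbers and `r + Σᵢ Cᵢ log εᵢ = 0` with real
  ALGEBRAIC `r, Cᵢ`, then `r = 0` and all `Cᵢ = 0` (Baker: `1, log ε₁, …, log ε_s` are linearly
  independent over `ℚ̄`).

Sources: A. Baker, *Transcendental Number Theory* (1975), Thm. 2.1; M. Kontsevich, D. Zagier,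
*Periods* (2001), §1.2. No definitions are introduced.
-/

noncomputable section

open Finset

namespace Summit.KontsevichZagierPeriods.HurwitzMicroSectors.NormalFormPrinciple.PiBox

namespace Dlog

/-! ## Integer powers of algebraic numbers -/

/-- Integer powers of a real algebraic number are algebraic. [folklore] -/
theorem isAlgebraic_zpow {a : ℝ} (ha : IsAlgebraic ℚ a) (n : ℤ) : IsAlgebraic ℚ (a ^ n) := by
  cases n with
  | ofNat k => simpa using ha.pow k
  | negSucc k =>
    rw [zpow_negSucc]
    exact (ha.pow (k + 1)).inv

/-- A finite product of integer powers of real algebraic numbers is algebraic. [folklore] -/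
theorem isAlgebraic_prod_zpow {ι : Type*} (s : Finset ι) (a : ι → ℝ) (n : ι → ℤ)
    (ha : ∀ i ∈ s, IsAlgebraic ℚ (a i)) : IsAlgebraic ℚ (∏ i ∈ s, a i ^ n i) := by
  classical
  induction s using Finset.induction_on with
  | empty => simpa using isAlgebraic_one
  | insert i s hi ih =>
    rw [Finset.prod_insert hi]
    exact (isAlgebraic_zpow (ha i (Finset.mem_insert_self i s)) (n i)).mul
      (ih fun j hj => ha j (Finset.mem_insert_of_mem hj))

/-! ## A torsion-free multiplicative basis -/

/-- **Exact monomials in a multiplicatively independent basis.** Positive real algebraic numbers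
`a₁, …, a_k` are exact monomials `aⱼ = ∏ᵢ εᵢ^{nⱼᵢ}` (`nⱼᵢ ∈ ℤ`) in finitely many real algebraic
`εᵢ > 1` with `ℚ`-linearly independent logarithms: take a `ℤ`-basis of the lattice
`Λ = Σⱼ ℤ log aⱼ ⊂ ℝ` (finitely generated and torsion-free, hence free), made positive, and
exponentiate. [folklore] -/
theorem exists_mulBasis {k : ℕ} (a : Fin k → ℝ) (ha0 : ∀ j, 0 < a j)
    (halg : ∀ j, IsAlgebraic ℚ (a j)) :
    ∃ (s : ℕ) (ε : Fin s → ℝ) (n : Fin k → Fin s → ℤ),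
      (∀ i, 1 < ε i) ∧ (∀ i, IsAlgebraic ℚ (ε i)) ∧
      LinearIndependent ℚ (fun i => Real.log (ε i)) ∧
      ∀ j, a j = ∏ i, ε i ^ n j i := by
  classical
  set v : Fin k → ℝ := fun j => Real.log (a j) with hv
  set M : Submodule ℤ ℝ := Submodule.span ℤ (Set.range v) with hM
  haveI : Module.Finite ℤ M := Module.Finite.span_of_finite ℤ (Set.finite_range v)
  haveI : Module.Free ℤ M := Module.free_of_finite_type_torsion_free'
  let b := Module.Free.chooseBasis ℤ M
  let ι := Module.Free.ChooseBasisIndex ℤ M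
  have hb0 : ∀ i, (b i : ℝ) ≠ 0 := fun i h => b.ne_zero i (Subtype.ext h)
  -- independence over `ℤ` in `ℝ`, then with the signs, then over `ℚ`
  have hliZ : LinearIndependent ℤ (fun i => (b i : ℝ)) :=
    b.linearIndependent.map' M.subtype (Submodule.ker_subtype M)
  let w : ι → ℤˣ := fun i => if 0 < (b i : ℝ) then 1 else -1
  have hwsq : ∀ i, ((w i : ℤ) : ℝ) * ((w i : ℤ) : ℝ) = 1 := by
    intro i
    by_cases h : 0 < (b i : ℝ)
    · simp [w, h]
    · simp [w, h]
  have habs : ∀ i, |(b i : ℝ)| = ((w i : ℤ) : ℝ) * (b i : ℝ) := by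
    intro i
    by_cases h : 0 < (b i : ℝ)
    · simp [w, h, abs_of_pos h]
    · have h' : (b i : ℝ) < 0 := lt_of_le_of_ne (not_lt.mp h) (hb0 i)
      simp [w, h, abs_of_neg h']
  have hliZ' : LinearIndependent ℤ (fun i => |(b i : ℝ)|) := by
    have h := hliZ.units_smul w
    convert h using 1
    funext i
    rw [habs i, Pi.smul_apply', Units.smul_def, zsmul_eq_mul]
  have hliQ : LinearIndependent ℚ (fun i => |(b i : ℝ)|) :=
    (LinearIndependent.iff_fractionRing ℤ ℚ).mp hliZ'
  -- each `b i` is an integer combination of the `log a j`, hence `exp (b i)` is algebraic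
  have halgexp : ∀ i, IsAlgebraic ℚ (Real.exp (|(b i : ℝ)|)) := by
    intro i
    have hmem : (b i : ℝ) ∈ Submodule.span ℤ (Set.range v) := (b i).2
    rw [Submodule.mem_span_range_iff_exists_fun] at hmem
    obtain ⟨m, hm⟩ := hmem
    have hexp : Real.exp (b i : ℝ) = ∏ j, a j ^ m j := by
      rw [← hm, Real.exp_sum]
      refine Finset.prod_congr rfl fun j _ => ?_
      rw [zsmul_eq_mul, show v j = Real.log (a j) from rfl, ← Real.log_zpow,
        Real.exp_log (zpow_pos (ha0 j) _)]
    have halg1 : IsAlgebraic ℚ (Real.exp (b i : ℝ)) := by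
      rw [hexp]
      exact isAlgebraic_prod_zpow _ _ _ fun j _ => halg j
    by_cases h : 0 ≤ (b i : ℝ)
    · rwa [abs_of_nonneg h]
    · rw [abs_of_neg (not_le.mp h), Real.exp_neg]
      exact halg1.inv
  -- coordinates of `log a j` in the (sign-corrected) basis
  have hcoord : ∀ j, Real.log (a j) =
      ∑ i, (((b.repr ⟨v j, Submodule.subset_span ⟨j, rfl⟩⟩ i : ℤ) * (w i : ℤ) : ℤ) : ℝ) *
        |(b i : ℝ)| := by
    intro j
    have h := b.sum_repr ⟨v j, Submodule.subset_span ⟨j, rfl⟩⟩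
    have h' := congrArg (fun x : M => (x : ℝ)) h
    simp only [Submodule.coe_sum, Submodule.coe_smul_of_tower] at h'
    calc Real.log (a j) = v j := rfl
      _ = ∑ x, (b.repr ⟨v j, Submodule.subset_span ⟨j, rfl⟩⟩ x) • ((b x : M) : ℝ) := h'.symm
      _ = _ := Finset.sum_congr rfl fun i _ => by
        rw [habs i, zsmul_eq_mul]
        push_cast
        linear_combination -((b.repr ⟨v j, Submodule.subset_span ⟨j, rfl⟩⟩ i : ℤ) : ℝ) *
          (b i : ℝ) * hwsq i
  -- transport to `Fin s`
  obtain ⟨s, ⟨eqv⟩⟩ : ∃ s, Nonempty (ι ≃ Fin s) := ⟨Fintype.card ι, ⟨Fintype.equivFin ι⟩⟩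
  refine ⟨s, fun i => Real.exp (|(b (eqv.symm i) : ℝ)|),
    fun j i => (b.repr ⟨v j, Submodule.subset_span ⟨j, rfl⟩⟩ (eqv.symm i) : ℤ) * (w (eqv.symm i) : ℤ),
    fun i => ?_, fun i => halgexp _, ?_, fun j => ?_⟩
  · exact Real.one_lt_exp_iff.mpr (abs_pos.mpr (hb0 _))
  · have h : (fun i : Fin s => Real.log (Real.exp (|(b (eqv.symm i) : ℝ)|))) =
        (fun i => |(b i : ℝ)|) ∘ eqv.symm := by
      funext i; simp
    rw [h]
    exact (linearIndependent_equiv eqv.symm).mpr hliQ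
  · rw [← Real.exp_log (ha0 j), hcoord j, Real.exp_sum, ← Equiv.prod_comp eqv.symm]
    refine Finset.prod_congr rfl fun i _ => ?_
    simp only
    conv_rhs => rw [← Real.exp_log (zpow_pos (Real.exp_pos (|(b (eqv.symm i) : ℝ)|)) _),
      Real.log_zpow, Real.log_exp]

/-! ## The Baker endgame -/

/-- **Baker, torsion-free form used by the moves.** If `ε₁, …, ε_s > 0` are real algebraic with
`ℚ`-linearly independent logarithms and `r + Σᵢ Cᵢ log εᵢ = 0` with real ALGEBRAIC `r, Cᵢ`, then
`r = 0` and every `Cᵢ = 0`: by Baker's theorem (`baker_holds`) `1, log ε₁, …, log ε_s` are linearly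
independent over the field of algebraic numbers. [cite: Baker1975, Theorem 2.1] -/
theorem eq_zero_of_alg_add_sum_mul_log_eq_zero {s : ℕ} (ε : Fin s → ℝ) (hε : ∀ i, 0 < ε i)
    (hεalg : ∀ i, IsAlgebraic ℚ (ε i)) (hli : LinearIndependent ℚ (fun i => Real.log (ε i)))
    (r : ℝ) (hr : IsAlgebraic ℚ r) (C : Fin s → ℝ) (hC : ∀ i, IsAlgebraic ℚ (C i))
    (h : r + ∑ i, C i * Real.log (ε i) = 0) : r = 0 ∧ ∀ i, C i = 0 := by
  classical
  set l : Fin s → ℂ := fun i => ((Real.log (ε i) : ℝ) : ℂ) with hl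
  have halg : ∀ i, IsAlgebraic ℚ (Complex.exp (l i)) := by
    intro i
    rw [hl]
    simp only
    rw [← Complex.ofReal_exp, Real.exp_log (hε i)]
    exact (isAlgebraic_algebraMap_iff (R := ℚ) (A := ℂ) Complex.ofReal_injective).mpr (hεalg i)
  have hliC : LinearIndependent ℚ l := by
    refine LinearIndependent.of_comp (Complex.reLm.restrictScalars ℚ) ?_
    have : ⇑(Complex.reLm.restrictScalars ℚ) ∘ l = fun i => Real.log (ε i) := by
      funext i; simp [hl]
    rw [this]
    exact hli
  have hB := Literature.NumberTheory.Transcendental.baker_holds l halg hliC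
  rw [Fintype.linearIndependent_iff] at hB
  -- the coefficient family in the algebraic closure of `ℚ` in `ℂ`
  have hmem : ∀ x : ℝ, IsAlgebraic ℚ x → (x : ℂ) ∈ algebraicClosure ℚ ℂ := fun x hx =>
    mem_algebraicClosure_iff.mpr
      ((isAlgebraic_algebraMap_iff (R := ℚ) (A := ℂ) Complex.ofReal_injective).mpr hx)
  set g : Option (Fin s) → algebraicClosure ℚ ℂ := fun o =>
    Option.elim o ⟨(r:ℂ), hmem r hr⟩ fun i => ⟨(C i : ℂ), hmem (C i) (hC i)⟩ with hg
  have hsum : ∑ o, g o • (Option.elim o (1:ℂ) l) = 0 := by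
    rw [Fintype.sum_option]
    simp only [hg, Option.elim_none, Option.elim_some, IntermediateField.smul_def, smul_eq_mul,
      mul_one, hl]
    have : (r:ℂ) + ∑ i, (C i : ℂ) * ((Real.log (ε i) : ℝ) : ℂ) = ((r + ∑ i, C i * Real.log (ε i) : ℝ) : ℂ) := by
      push_cast; rfl
    rw [this, h, Complex.ofReal_zero]
  have h0 := hB g hsum
  refine ⟨?_, fun i => ?_⟩
  · have h1 := congrArg (fun x : algebraicClosure ℚ ℂ => (x : ℂ)) (h0 none)
    simp only [hg, Option.elim_none, ZeroMemClass.coe_zero] at h1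
    exact Complex.ofReal_eq_zero.mp h1
  · have h1 := congrArg (fun x : algebraicClosure ℚ ℂ => (x : ℂ)) (h0 (some i))
    simp only [hg, Option.elim_some, ZeroMemClass.coe_zero] at h1
    exact Complex.ofReal_eq_zero.mp h1

end Dlog

end Summit.KontsevichZagierPeriods.HurwitzMicroSectors.NormalFormPrinciple.PiBox
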